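/-
Copyright (c) 2026 the pub-hodgecm-mathlib formalisation cell (harness21).  Prover seat hodgecm-mathlib-K2E4-p14 (g6), Track B ∕ K2-LIT, h413 =
`stmt-HodgeConjecture-24833`, line `K2_E1_TraceFormulaBeta`, campaign «EIS-WHITTAKER-2» letter «W3-cov»; DEAL of the dealer K2E1-plan (g4) 2026-09-04T07:11:03Z (ii) ∕
07:13:23Z ∕ 07:19:15Z (REPORT-FIRST census∕heads on the K2 bus).
-/
import Summits.HodgeConjecture.HodgeConjecture.Theorems.K2E1EisensteinMinusConstantTermPoissonU2   -- ★ W1 (K2E1-p09 g4): `Φ_g(t) = f(w₀·n(θt)·g)`, `adeleFourierCoeff`, the chart `n(θt)`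
import Summits.HodgeConjecture.HodgeConjecture.Theorems.K2E1IntertwiningGrowthU2                 -- ★ [D8]₂ (this seat, g5): §1 `H(w₀ t₀ y) = ‖d₀‖⁻¹·H(w₀ y)`; imports ★ `UnitaryGroupBorelModulusTwo`
import Literature.NumberTheory.Automorphic.AdelicPoissonScaled                                    -- ★ Tate 4.1.2 `adeleFourierCoeff_comp_mul_sub` (translation ∕ dilation of `𝓕` on `𝔸_F`)
import Literature.NumberTheory.Automorphic.UnitaryGroupTraceZeroLineHaar                          -- ★ `traceZeroModulus_ideleBaseChange` (`χ⁻(α⊗1) = ‖α‖_F`)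
import HarnessLib

/-!
# K2·E1 — `K2E1WhittakerCoefficientCovarianceU2`: COVARIANCE OF THE BIG-CELL FOURIER COEFFICIENTS `W_ξ(g) = 𝓕Φ_g(ξ)` OF `U(J₂)` UNDER `g = n(θx)·t₀·k`
# (campaign «EIS-WHITTAKER-2», letter «W3-cov», dealer K2E1-plan (g4) 2026-09-04T07:11:03Z (ii): reduces every Whittaker coefficient to `g = 1` at a dilated frequency)

Track B ∕ K2-LIT, crux h413 = `stmt-HodgeConjecture-24833`, route of record `HCCMUnconditional`; cell `hodgecm-mathlib`, squad K2, ENGINE E1.  Prover seat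
`hodgecm-mathlib-K2E4-p14` (g6).  THEOREMS ONLY (no `def`, no `instance`, no notation, no named-fact hypothesis, no `sorry`); lane `--supports stmt-HodgeConjecture-24833 --as helper`
(count-neutral).  Closes no socket.  Generic CM-type quadratic `(F, E, c)`, `c δ = −δ ≠ 0`, `N = 2`.

THE MATHEMATICS [MoeglinWaldspurger1995, I.2.6, II.1.7; Garrett2018, §2.8–§2.9; CasselsFrohlichANT1967, Ch. XV 4.1.2].  `G = U(J₂)(𝔸_F)`, `w₀ = ι(J₂)`, the unipotent radical is
the LINE `θ : 𝔸_F ≅ 𝔸_E⁻ ≅ N(𝔸_F)`, `t ↦ n(θ t)`, `θ t = (t ⊗ 1)·δ` (★ `traceZeroLine`, ★ `middleRootUnipotent`), and W1 ★ writes `E(f) − E(f)_B` as the sum over `ξ ∈ F^×` of the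
Fourier coefficients `𝓕Φ_g(ξ) = ∫_{𝔸_F} Φ_g(t)·ψ_F(ξt) dμ(t)` of the big-cell function `Φ_g(t) := f(w₀·n(θt)·g)`.  Let `g = n(θx)·t₀·k` (`x ∈ 𝔸_F`, `t₀ = diag(d₀,d₁) ∈ T(𝔸_F)`, `k ∈ K_U`;
Iwasawa ★).  §1 LINE ALGEBRA: `n(θt)·n(θx) = n(θ(t+x))` (★ `middleRootUnipotent_add_two`); the line scalar `λ = d₀⁻¹d₁` of `t₀` is `c`-fixed (★ `conjAdele_lineScalar_two`), hence
`λ = α ⊗ 1` for an idele `α` of `F` (★ quadratic Galois descent `exists_ideleBaseChange_eq_of_conjAdele_eq`) with **`‖α‖_{𝔸_F} = ‖d₀‖_{𝔸_E}⁻¹`** (★ `traceZeroModulus_ideleBaseChange`, ★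
`traceZeroModulus_lineScalar_inv_two`, ★ `torusRootModulus_two_eq`), and `n(θs)·t₀ = t₀·n(θ(α s))` (★ `torusConj_middleRootUnipotent_two`, ★ `traceZeroLine_units_mul`).  §2 THE BIG-CELL
FUNCTION: for ANY right-`K_U`-invariant `f`, `f(w₀·n(θt)·n(θx)·t₀·k) = f(w₀·t₀·n(θ(α(t+x))))`; for a flat section `f = φ·H^z` whose coefficient is right-`K_U`-invariant and torus-transparent
along the big cell (`φ(w₀ t₀ y) = φ(w₀ y)` — constants, every left-`T(𝔸)N(𝔸)`-invariant `φ`), ★ [D8]₂ §1 `H(w₀ t₀ y) = ‖d₀‖⁻¹ H(w₀ y)` gives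
**`Φ_{n(θx)t₀k}(t) = ‖d₀‖_E^{−z} · Φ₁(α·(t + x))`**, `Φ₁(s) := f(w₀·n(θs))`.  §3 FOURIER: Tate's change of variables ★ `adeleFourierCoeff_comp_mul_sub` (`λ = α`, `y = −x`) yields
**`𝓕Φ_{n(θx)t₀k}(ξ) = ‖d₀‖_E^{−z} · ψ_F(−ξx) · ‖α‖_F⁻¹ · ∫ Φ₁(v)·ψ_F(ξα⁻¹v) dμ(v) = ‖d₀‖_E^{1−z} · ψ_F(−ξx) · ∫ Φ₁(v)·ψ_F(ξα⁻¹v) dμ(v)`** — every Whittaker coefficient `W_ξ(g, z)` is the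
`g = 1` transform at the DILATED ADELIC frequency `ξα⁻¹` (explicit integral; Meyer's `adeleFourier`), times the phase `ψ_F(−ξx)` and the modulus `‖d₀‖_E^{1−z}`.  This moves W3 (`g ∈ K_U`) to
general `g` and feeds W4∕W5.  CONVENTIONS = W1's: `μ` any additive Haar measure of `𝔸_F`, `ψ_F = adeleAddChar F`, `𝓕Φ(ξ) = ∫ Φ(u)ψ_F(ξu) dμ`.
HONEST LABEL: HC_CM is proved only modulo the 7 printed citations (2 remaining named inputs: hLiu418 = `stmt-HodgeConjecture-24832`, h413 = `stmt-HodgeConjecture-24833`) until rung 0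
closes; this file asserts no named fact and closes no socket.
References: [MoeglinWaldspurger1995] I.2.6, II.1.7 · [Garrett2018] §2.8–§2.9 · [CasselsFrohlichANT1967] Ch. II §14, Ch. XV Lemma 4.1.2 · [Rogawski1990] §1.10, §2.2 · [GetzHahn2024] §3.5.
-/

set_option autoImplicit false
-- the mandated namespace repeats the single-problem summit's segment (`HodgeConjecture.HodgeConjecture`)
set_option linter.dupNamespace false

noncomputable section

open MeasureTheory Measure NumberField IsDedekindDomain Set MulAction Filter Matrix
open scoped ENNReal NNReal ComplexConjugate MatrixGroups
open Literature.NumberTheory Literature.NumberTheory.Automorphic Literature.NumberTheory.Automorphic.UnitaryGroup AdelicGroupData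
open Summit.HodgeConjecture.HodgeConjecture.Cruxes.H413.K2E1BorelEisensteinU
open Summit.HodgeConjecture.HodgeConjecture.Cruxes.H413.K2E1IntertwiningGrowthU2 (borelHeight_weylLongU_mul_diag_mul)

namespace Summit.HodgeConjecture.HodgeConjecture.Cruxes.H413.K2E1WhittakerCoefficientCovarianceU2

variable {F E : Type} [Field F] [NumberField F] [Field E] [NumberField E] [Algebra F E] [Algebra.IsQuadraticExtension F E] {c : E ≃ₐ[F] E}
  (hij : (((0 : Fin 2) : ℕ)) + 1 = ((1 : Fin 2) : ℕ)) (hN : 2 = 2 * ((0 : Fin 2) : ℕ) + 2) {δ : E} (hcδ : c δ = -δ) (hδ : δ ≠ 0)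

/-! ## §1 Line algebra in `U(J₂)(𝔸_F)`: `n(θt)·n(θx) = n(θ(t+x))`, the line idele `α` of `t₀` (`α ⊗ 1 = d₀⁻¹d₁`, `‖α‖_F = ‖d₀‖_E⁻¹`), `n(θs)·t₀ = t₀·n(θ(αs))` -/

/-- **`n(θ t)·n(θ x) = n(θ(t + x))`**: the chart `t ↦ n(θ t)` of `N(𝔸_F)` is additive (★ `middleRootUnipotent_add_two`, `θ` additive). [cite: Rogawski1990, §1.10] -/
theorem chart_mul_chart (t x : AdeleRing (𝓞 F) F) : ((middleRootUnipotent hij hN (Multiplicative.ofAdd (traceZeroLine F E c hcδ hδ (t))) : ↥(adelicUnipotent F E c 2)) : (quasiSplit F E c 2).Adelic) * ((middleRootUnipotent hij hN (Multiplicative.ofAdd (traceZeroLine F E c hcδ hδ (x))) : ↥(adelicUnipotent F E c 2)) : (quasiSplit F E c 2).Adelic) = ((middleRootUnipotent hij hN (Multiplicative.ofAdd (traceZeroLine F E c hcδ hδ (t + x))) : ↥(adelicUnipotent F E c 2)) : (quasiSplit F E c 2).Adelic) := by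
  rw [map_add (traceZeroLine F E c hcδ hδ), middleRootUnipotent_add_two hij hN, Subgroup.coe_mul]

include hcδ hδ in
/-- **THE LINE IDELE OF A TORUS ELEMENT**: for `t₀ = diag(d₀, d₁) ∈ T(𝔸_F)` there is an idele `α` of `F` with `α ⊗ 1 = d₀⁻¹·d₁` (the line scalar is `c`-fixed ★ `conjAdele_lineScalar_two`, quadratic Galois
descent ★ `exists_ideleBaseChange_eq_of_conjAdele_eq`) and **`‖α‖_{𝔸_F} = ‖d₀‖_{𝔸_E}⁻¹`** (★ `traceZeroModulus_ideleBaseChange`: `χ⁻(α⊗1) = ‖α‖_F`; ★ `traceZeroModulus_lineScalar_inv_two` and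
★ `torusRootModulus_two_eq`: `χ⁻(d₀⁻¹d₁)⁻¹ = δ_B(t₀) = ‖d₀‖_E`). [cite: CasselsFrohlichANT1967, Ch. II §14 and Ch. XV Lemma 4.1.2] [cite: Rogawski1990, §2.2] -/
theorem exists_lineIdele (hc : c * c = 1) (hc1 : c ≠ 1) (t₀ : torusInBorel F E c 2) {d : Fin 2 → (AdeleRing (𝓞 E) E)ˣ}
    (hd : glDiagonal 2 (AdeleRing (𝓞 E) E) d = adelicVal F E c 2 _ ((t₀ : borelAdelic F E c 2) : (quasiSplit F E c 2).Adelic)) :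
    ∃ α : (AdeleRing (𝓞 F) F)ˣ, AdeleRing.ideleBaseChange F E α = (d 0)⁻¹ * d 1 ∧ IdeleClassGroup.ideleNorm F α = (IdeleClassGroup.ideleNorm E (d 0))⁻¹ := by
  haveI := locallyCompactSpace_adeleRing' E
  haveI := locallyCompactSpace_adeleRing' F
  letI : MeasurableSpace (AdeleRing (𝓞 E) E) := borel _
  haveI : BorelSpace (AdeleRing (𝓞 E) E) := ⟨rfl⟩
  letI : MeasurableSpace (AdeleRing (𝓞 F) F) := borel _
  haveI : BorelSpace (AdeleRing (𝓞 F) F) := ⟨rfl⟩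
  obtain ⟨α, hα⟩ := exists_ideleBaseChange_eq_of_conjAdele_eq (E := E) (c := c) hcδ hδ (conjAdele_lineScalar_two t₀ hd)
  refine ⟨α, hα, ?_⟩
  have h1 := traceZeroModulus_ideleBaseChange (E := E) (c := c) hcδ hδ α
  have h2 := traceZeroModulus_lineScalar_inv_two hc hc1 t₀ hd
  rw [torusRootModulus_two_eq t₀ hd, AdeleRing.distribHaarChar_eq_ideleNorm] at h2
  have h3 : ∀ (l : (AdeleRing (𝓞 E) E)ˣ) (hl : conjAdele F E c (l : AdeleRing (𝓞 E) E) = l), l = (d 0)⁻¹ * d 1 →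
      traceZeroModulus l hl = traceZeroModulus ((d 0)⁻¹ * d 1) (conjAdele_lineScalar_two t₀ hd) := by
    rintro l hl rfl
    rfl
  rw [← h1, h3 _ (conjAdele_ideleBaseChange E c α) hα, ← h2, inv_inv]

/-- **`n(θ s)·t₀ = t₀·n(θ(α·s))`**: conjugation by `t₀ = diag(d)` scales the line by `λ = d₀⁻¹d₁ = α ⊗ 1` (★ `torusConj_middleRootUnipotent_two`), and `θ(α s) = (α⊗1)•θ(s)`
(★ `traceZeroLine_units_mul`). [cite: Rogawski1990, §1.10] -/
theorem chart_mul_torus (t₀ : torusInBorel F E c 2) {d : Fin 2 → (AdeleRing (𝓞 E) E)ˣ}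
    (hd : glDiagonal 2 (AdeleRing (𝓞 E) E) d = adelicVal F E c 2 _ ((t₀ : borelAdelic F E c 2) : (quasiSplit F E c 2).Adelic)) {α : (AdeleRing (𝓞 F) F)ˣ} (hα : AdeleRing.ideleBaseChange F E α = (d 0)⁻¹ * d 1)
    (s : AdeleRing (𝓞 F) F) : ((middleRootUnipotent hij hN (Multiplicative.ofAdd (traceZeroLine F E c hcδ hδ (s))) : ↥(adelicUnipotent F E c 2)) : (quasiSplit F E c 2).Adelic) * ((t₀ : borelAdelic F E c 2) : (quasiSplit F E c 2).Adelic) = ((t₀ : borelAdelic F E c 2) : (quasiSplit F E c 2).Adelic) * ((middleRootUnipotent hij hN (Multiplicative.ofAdd (traceZeroLine F E c hcδ hδ ((α : AdeleRing (𝓞 F) F) * s))) : ↥(adelicUnipotent F E c 2)) : (quasiSplit F E c 2).Adelic) := by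
  have hsm : smulTraceZero ((d 0)⁻¹ * d 1) (conjAdele_lineScalar_two t₀ hd) (traceZeroLine F E c hcδ hδ s) = traceZeroLine F E c hcδ hδ ((α : AdeleRing (𝓞 F) F) * s) := by
    apply Subtype.ext
    rw [coe_smulTraceZero, traceZeroLine_units_mul (E := E) (c := c) hcδ hδ α s, coe_smulTraceZero, hα]
  have key := congrArg (fun u : ↥(adelicUnipotent F E c 2) => (u : (quasiSplit F E c 2).Adelic)) (torusConj_middleRootUnipotent_two hij hN t₀ hd (traceZeroLine F E c hcδ hδ s))
  dsimp only at key
  rw [hsm] at key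
  rw [← key]
  group

/-! ## §2 The big-cell function along the line under `g = n(θx)·t₀·k` -/

/-- **`f(w₀·n(θt)·n(θx)·t₀·k) = f(w₀·t₀·n(θ(α(t+x))))`** for ANY right-`K_U`-invariant `f` (§1: additivity of the chart, `n(θs)·t₀ = t₀·n(θ(αs))`). [cite: MoeglinWaldspurger1995, II.1.7]
[cite: Garrett2018, §2.8] -/
theorem apply_bigCellLine_chart_torus (t₀ : torusInBorel F E c 2) {d : Fin 2 → (AdeleRing (𝓞 E) E)ˣ}
    (hd : glDiagonal 2 (AdeleRing (𝓞 E) E) d = adelicVal F E c 2 _ ((t₀ : borelAdelic F E c 2) : (quasiSplit F E c 2).Adelic)) {α : (AdeleRing (𝓞 F) F)ˣ} (hα : AdeleRing.ideleBaseChange F E α = (d 0)⁻¹ * d 1)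
    {f : (quasiSplit F E c 2).Adelic → ℂ} (hfK : ∀ y : (quasiSplit F E c 2).Adelic, ∀ k ∈ ((standardMaximalCompactGL 2 E).comap (adelicVal F E c 2 ((StdForm.antidiagonal 2).over E)) : Subgroup (quasiSplit F E c 2).Adelic), f (y * k) = f y) (x t : AdeleRing (𝓞 F) F) {k : (quasiSplit F E c 2).Adelic} (hk : k ∈ ((standardMaximalCompactGL 2 E).comap (adelicVal F E c 2 ((StdForm.antidiagonal 2).over E)) : Subgroup (quasiSplit F E c 2).Adelic)) :
    f ((quasiSplit F E c 2).toAdelic (weylLongU (c : E →+* E) (rfl : (StdForm.antidiagonal 2).over E = (StdForm.antidiagonal 2).over E)) * (((middleRootUnipotent hij hN (Multiplicative.ofAdd (traceZeroLine F E c hcδ hδ (t))) : ↥(adelicUnipotent F E c 2)) : (quasiSplit F E c 2).Adelic) * (((middleRootUnipotent hij hN (Multiplicative.ofAdd (traceZeroLine F E c hcδ hδ (x))) : ↥(adelicUnipotent F E c 2)) : (quasiSplit F E c 2).Adelic) * (((t₀ : borelAdelic F E c 2) : (quasiSplit F E c 2).Adelic) * k)))) = f ((quasiSplit F E c 2).toAdelic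 (weylLongU (c : E →+* E) (rfl : (StdForm.antidiagonal 2).over E = (StdForm.antidiagonal 2).over E)) * (((t₀ : borelAdelic F E c 2) : (quasiSplit F E c 2).Adelic) * ((middleRootUnipotent hij hN (Multiplicative.ofAdd (traceZeroLine F E c hcδ hδ ((α : AdeleRing (𝓞 F) F) * (t + x)))) : ↥(adelicUnipotent F E c 2)) : (quasiSplit F E c 2).Adelic))) := by
  have h1 : ((middleRootUnipotent hij hN (Multiplicative.ofAdd (traceZeroLine F E c hcδ hδ (t))) : ↥(adelicUnipotent F E c 2)) : (quasiSplit F E c 2).Adelic) * (((middleRootUnipotent hij hN (Multiplicative.ofAdd (traceZeroLine F E c hcδ hδ (x))) : ↥(adelicUnipotent F E c 2)) : (quasiSplit F E c 2).Adelic) * (((t₀ : borelAdelic F E c 2) : (quasiSplit F E c 2).Adelic) * k)) = ((t₀ : borelAdelic F E c 2) : (quasiSplit F E c 2).Adelic) * ((middleRootUnipotent hij hN (Multiplicative.ofAdd (traceZeroLine F E c hcδ hδ ((α : AdeleRing (𝓞 F) F) * (t + x)))) : ↥(adelicUnipotent F E c 2)) : (quasiSplit F E c 2).Adelic) * k :=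 by
    rw [← mul_assoc, chart_mul_chart hij hN hcδ hδ, ← mul_assoc, chart_mul_torus hij hN hcδ hδ t₀ hd hα]
  rw [h1, ← mul_assoc ((quasiSplit F E c 2).toAdelic (weylLongU (c : E →+* E) (rfl : (StdForm.antidiagonal 2).over E = (StdForm.antidiagonal 2).over E))), hfK _ k hk]

/-- **`Φ_{n(θx)t₀k}(t) = ‖d₀‖_E^{−z} · Φ₁(α·(t + x))`** for the flat section `f = φ·H^z` with `φ` right-`K_U`-invariant and torus-transparent along the big cell (`φ(w₀ t₀ y) = φ(w₀ y)`),
`Φ₁(s) := f(w₀·n(θs))`: the previous lemma, then `H(w₀ t₀ y) = ‖d₀‖⁻¹ H(w₀ y)` (★ [D8]₂ `borelHeight_weylLongU_mul_diag_mul`) and `(‖d₀‖⁻¹h)^z = ‖d₀‖^{−z}h^z`.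
[cite: MoeglinWaldspurger1995, II.1.7] [cite: Garrett2018, §2.8] -/
theorem flatSectionU_bigCellLine_chart_torus (t₀ : torusInBorel F E c 2) {d : Fin 2 → (AdeleRing (𝓞 E) E)ˣ}
    (hd : glDiagonal 2 (AdeleRing (𝓞 E) E) d = adelicVal F E c 2 _ ((t₀ : borelAdelic F E c 2) : (quasiSplit F E c 2).Adelic)) {α : (AdeleRing (𝓞 F) F)ˣ} (hα : AdeleRing.ideleBaseChange F E α = (d 0)⁻¹ * d 1)
    {φ : (quasiSplit F E c 2).Adelic → ℂ} (hφK : ∀ y : (quasiSplit F E c 2).Adelic, ∀ k ∈ ((standardMaximalCompactGL 2 E).comap (adelicVal F E c 2 ((StdForm.antidiagonal 2).over E)) : Subgroup (quasiSplit F E c 2).Adelic), φ (y * k) = φ y) (hφT : ∀ y : (quasiSplit F E c 2).Adelic, φ ((quasiSplit F E c 2).toAdelic (weylLongU (c : E →+* E) (rfl : (StdForm.antidiagonal 2).over E = (StdForm.antidiagonal 2).over E)) * (((t₀ : borelAdelic F E c 2) : (quasiSplit F E c 2).Adelic) * y)) = φ ((quasiSplit F E c 2).toAdelic (weylLongU (c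 : E →+* E) (rfl : (StdForm.antidiagonal 2).over E = (StdForm.antidiagonal 2).over E)) * y)) (z : ℂ)
    (x t : AdeleRing (𝓞 F) F) {k : (quasiSplit F E c 2).Adelic} (hk : k ∈ ((standardMaximalCompactGL 2 E).comap (adelicVal F E c 2 ((StdForm.antidiagonal 2).over E)) : Subgroup (quasiSplit F E c 2).Adelic)) :
    flatSectionU φ z ((quasiSplit F E c 2).toAdelic (weylLongU (c : E →+* E) (rfl : (StdForm.antidiagonal 2).over E = (StdForm.antidiagonal 2).over E)) * (((middleRootUnipotent hij hN (Multiplicative.ofAdd (traceZeroLine F E c hcδ hδ (t))) : ↥(adelicUnipotent F E c 2)) : (quasiSplit F E c 2).Adelic) * (((middleRootUnipotent hij hN (Multiplicative.ofAdd (traceZeroLine F E c hcδ hδ (x))) : ↥(adelicUnipotent F E c 2)) : (quasiSplit F E c 2).Adelic) * (((t₀ : borelAdelic F E c 2) : (quasiSplit F E c 2).Adelic) * k)))) =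
      ((IdeleClassGroup.ideleNorm E (d 0) : ℝ) : ℂ) ^ (-z) * flatSectionU φ z ((quasiSplit F E c 2).toAdelic (weylLongU (c : E →+* E) (rfl : (StdForm.antidiagonal 2).over E = (StdForm.antidiagonal 2).over E)) * ((middleRootUnipotent hij hN (Multiplicative.ofAdd (traceZeroLine F E c hcδ hδ ((α : AdeleRing (𝓞 F) F) * (t + x)))) : ↥(adelicUnipotent F E c 2)) : (quasiSplit F E c 2).Adelic)) := by
  have hfK : ∀ y : (quasiSplit F E c 2).Adelic, ∀ k ∈ ((standardMaximalCompactGL 2 E).comap (adelicVal F E c 2 ((StdForm.antidiagonal 2).over E)) : Subgroup (quasiSplit F E c 2).Adelic), flatSectionU φ z (y * k) = flatSectionU φ z y := fun y k hk => by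
    rw [flatSectionU_apply, flatSectionU_apply, hφK y k hk, borelHeight_mul_of_mem_comap_standardMaximalCompactGL hk]
  have hpos : (0 : ℝ) < (IdeleClassGroup.ideleNorm E (d 0) : ℝ) := ideleNorm_real_pos _
  have harg : (((IdeleClassGroup.ideleNorm E (d 0) : ℝ) : ℂ)).arg ≠ Real.pi := by
    rw [Complex.arg_ofReal_of_nonneg hpos.le]; exact Real.pi_ne_zero.symm
  rw [apply_bigCellLine_chart_torus hij hN hcδ hδ t₀ hd hα hfK x t hk, flatSectionU_apply, flatSectionU_apply, hφT, borelHeight_weylLongU_mul_diag_mul hd,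
    NNReal.coe_mul, NNReal.coe_inv, Complex.ofReal_mul, Complex.mul_cpow_ofReal_nonneg (inv_nonneg.2 (NNReal.coe_nonneg _)) (NNReal.coe_nonneg _),
    Complex.ofReal_inv, Complex.inv_cpow _ _ harg, ← Complex.cpow_neg]
  ring

/-! ## §3 The Fourier coefficients: `𝓕Φ_{n(θx)t₀k}(ξ) = ‖d₀‖_E^{1−z}·ψ_F(−ξx)·∫ Φ₁(v)ψ_F(ξα⁻¹v) dμ` -/

section Fourier

variable [MeasurableSpace (AdeleRing (𝓞 F) F)] [BorelSpace (AdeleRing (𝓞 F) F)]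

omit [Algebra.IsQuadraticExtension F E] [BorelSpace (AdeleRing (𝓞 F) F)] in
/-- A constant comes out of a Fourier coefficient: `𝓕[C·Φ](ξ) = C·𝓕Φ(ξ)`. [folklore] -/
theorem adeleFourierCoeff_const_mul (μ : Measure (AdeleRing (𝓞 F) F)) (C : ℂ) (Φ : AdeleRing (𝓞 F) F → ℂ) (ξ : F) :
    adeleFourierCoeff μ (fun t => C * Φ t) ξ = C * adeleFourierCoeff μ Φ ξ := by
  simp only [adeleFourierCoeff_apply, mul_assoc]
  exact integral_const_mul _ _

/-- **COVARIANCE OF THE BIG-CELL FOURIER COEFFICIENTS, RAW FORM**: for `f = φ·H^z` as in §2, `g = n(θx)·t₀·k`, `α ⊗ 1 = d₀⁻¹d₁`, every `ξ ∈ F` and every additive Haar measure `μ` of `𝔸_F`,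
`𝓕Φ_g(ξ) = ‖d₀‖_E^{−z} · ψ_F(ξ·(−x)) · (‖α‖_F⁻¹ • ∫ Φ₁(v)·ψ_F(ξ·α⁻¹·v) dμ(v))` — §2 and Tate's change of variables ★ `adeleFourierCoeff_comp_mul_sub` (`λ = α`, `y = −x`).
[cite: CasselsFrohlichANT1967, Ch. XV Lemma 4.1.2] [cite: Garrett2018, §2.9] -/
theorem adeleFourierCoeff_bigCellLine_chart_torus (μ : Measure (AdeleRing (𝓞 F) F)) [μ.IsAddHaarMeasure] (t₀ : torusInBorel F E c 2) {d : Fin 2 → (AdeleRing (𝓞 E) E)ˣ}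
    (hd : glDiagonal 2 (AdeleRing (𝓞 E) E) d = adelicVal F E c 2 _ ((t₀ : borelAdelic F E c 2) : (quasiSplit F E c 2).Adelic)) {α : (AdeleRing (𝓞 F) F)ˣ} (hα : AdeleRing.ideleBaseChange F E α = (d 0)⁻¹ * d 1)
    {φ : (quasiSplit F E c 2).Adelic → ℂ} (hφK : ∀ y : (quasiSplit F E c 2).Adelic, ∀ k ∈ ((standardMaximalCompactGL 2 E).comap (adelicVal F E c 2 ((StdForm.antidiagonal 2).over E)) : Subgroup (quasiSplit F E c 2).Adelic), φ (y * k) = φ y) (hφT : ∀ y : (quasiSplit F E c 2).Adelic, φ ((quasiSplit F E c 2).toAdelic (weylLongU (c : E →+* E) (rfl : (StdForm.antidiagonal 2).over E = (StdForm.antidiagonal 2).over E)) * (((t₀ : borelAdelic F E c 2) : (quasiSplit F E c 2).Adelic) * y)) = φ ((quasiSplit F E c 2).toAdelic (weylLongU (c : E →+* E) (rfl : (StdForm.antidiagonal 2).over E = (StdForm.antidiagonal 2).over E)) * y)) (z : ℂ)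
    (x : AdeleRing (𝓞 F) F) {k : (quasiSplit F E c 2).Adelic} (hk : k ∈ ((standardMaximalCompactGL 2 E).comap (adelicVal F E c 2 ((StdForm.antidiagonal 2).over E)) : Subgroup (quasiSplit F E c 2).Adelic)) (ξ : F) :
    adeleFourierCoeff μ (fun t : AdeleRing (𝓞 F) F => flatSectionU φ z ((quasiSplit F E c 2).toAdelic (weylLongU (c : E →+* E) (rfl : (StdForm.antidiagonal 2).over E = (StdForm.antidiagonal 2).over E)) * (((middleRootUnipotent hij hN (Multiplicative.ofAdd (traceZeroLine F E c hcδ hδ (t))) : ↥(adelicUnipotent F E c 2)) : (quasiSplit F E c 2).Adelic) * (((middleRootUnipotent hij hN (Multiplicative.ofAdd (traceZeroLine F E c hcδ hδ (x))) : ↥(adelicUnipotent F E c 2)) : (quasiSplit F E c 2).Adelic) * (((t₀ : borelAdelic F E c 2) : (quasiSplit F E c 2).Adelic) * k))))) ξ =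
      ((IdeleClassGroup.ideleNorm E (d 0) : ℝ) : ℂ) ^ (-z) *
        ((adeleAddChar F (algebraMap F (AdeleRing (𝓞 F) F) ξ * -x) : ℂ) *
          ((((IdeleClassGroup.ideleNorm F α : ℝ≥0) : ℝ)⁻¹ : ℝ) •
            ∫ v, flatSectionU φ z ((quasiSplit F E c 2).toAdelic (weylLongU (c : E →+* E) (rfl : (StdForm.antidiagonal 2).over E = (StdForm.antidiagonal 2).over E)) * ((middleRootUnipotent hij hN (Multiplicative.ofAdd (traceZeroLine F E c hcδ hδ (v))) : ↥(adelicUnipotent F E c 2)) : (quasiSplit F E c 2).Adelic)) * (adeleAddChar F (algebraMap F (AdeleRing (𝓞 F) F) ξ * ((α⁻¹ : (AdeleRing (𝓞 F) F)ˣ) : AdeleRing (𝓞 F) F) * v) : ℂ) ∂μ)) := by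
  have hpt : (fun t : AdeleRing (𝓞 F) F => flatSectionU φ z ((quasiSplit F E c 2).toAdelic (weylLongU (c : E →+* E) (rfl : (StdForm.antidiagonal 2).over E = (StdForm.antidiagonal 2).over E)) * (((middleRootUnipotent hij hN (Multiplicative.ofAdd (traceZeroLine F E c hcδ hδ (t))) : ↥(adelicUnipotent F E c 2)) : (quasiSplit F E c 2).Adelic) * (((middleRootUnipotent hij hN (Multiplicative.ofAdd (traceZeroLine F E c hcδ hδ (x))) : ↥(adelicUnipotent F E c 2)) : (quasiSplit F E c 2).Adelic) * (((t₀ : borelAdelic F E c 2) : (quasiSplit F E c 2).Adelic) * k))))) =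
      fun t : AdeleRing (𝓞 F) F => ((IdeleClassGroup.ideleNorm E (d 0) : ℝ) : ℂ) ^ (-z) *
        (fun s : AdeleRing (𝓞 F) F => flatSectionU φ z ((quasiSplit F E c 2).toAdelic (weylLongU (c : E →+* E) (rfl : (StdForm.antidiagonal 2).over E = (StdForm.antidiagonal 2).over E)) * ((middleRootUnipotent hij hN (Multiplicative.ofAdd (traceZeroLine F E c hcδ hδ (s))) : ↥(adelicUnipotent F E c 2)) : (quasiSplit F E c 2).Adelic))) ((α : AdeleRing (𝓞 F) F) * (t - -x)) := by
    funext t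
    rw [flatSectionU_bigCellLine_chart_torus hij hN hcδ hδ t₀ hd hα hφK hφT z x t hk, sub_neg_eq_add]
  rw [hpt, adeleFourierCoeff_const_mul, adeleFourierCoeff_comp_mul_sub F μ (fun s : AdeleRing (𝓞 F) F => flatSectionU φ z ((quasiSplit F E c 2).toAdelic (weylLongU (c : E →+* E) (rfl : (StdForm.antidiagonal 2).over E = (StdForm.antidiagonal 2).over E)) * ((middleRootUnipotent hij hN (Multiplicative.ofAdd (traceZeroLine F E c hcδ hδ (s))) : ↥(adelicUnipotent F E c 2)) : (quasiSplit F E c 2).Adelic))) α (-x) ξ]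

/-- **COVARIANCE OF THE BIG-CELL FOURIER COEFFICIENTS** (letter «W3-cov»; W1's spelling `Φ_g(t) = f(w₀·n(θt)·g)`, `g = n(θx)·t₀·k` any Iwasawa triple): with the line idele normalised by
`‖α‖_F = ‖d₀‖_E⁻¹` (★ `exists_lineIdele`),
**`𝓕Φ_{n(θx)·t₀·k}(ξ) = ‖d₀‖_E^{1−z} · ψ_F(ξ·(−x)) · ∫ Φ₁(v)·ψ_F(ξ·α⁻¹·v) dμ(v)`**, `Φ₁(s) = f(w₀·n(θs))`: every Whittaker coefficient `W_ξ(g, z)` of the flat section is the `g = 1` transform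
at the dilated adelic frequency `ξα⁻¹`, times the phase `ψ_F(−ξx)` and the modulus `‖d₀‖_E^{1−z}`. [cite: MoeglinWaldspurger1995, II.1.7] [cite: Garrett2018, §2.8–§2.9]
[cite: CasselsFrohlichANT1967, Ch. XV Lemma 4.1.2] -/
theorem adeleFourierCoeff_bigCellLine_covariance (μ : Measure (AdeleRing (𝓞 F) F)) [μ.IsAddHaarMeasure] (t₀ : torusInBorel F E c 2) {d : Fin 2 → (AdeleRing (𝓞 E) E)ˣ}
    (hd : glDiagonal 2 (AdeleRing (𝓞 E) E) d = adelicVal F E c 2 _ ((t₀ : borelAdelic F E c 2) : (quasiSplit F E c 2).Adelic)) {α : (AdeleRing (𝓞 F) F)ˣ} (hα : AdeleRing.ideleBaseChange F E α = (d 0)⁻¹ * d 1)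
    (hα' : IdeleClassGroup.ideleNorm F α = (IdeleClassGroup.ideleNorm E (d 0))⁻¹)
    {φ : (quasiSplit F E c 2).Adelic → ℂ} (hφK : ∀ y : (quasiSplit F E c 2).Adelic, ∀ k ∈ ((standardMaximalCompactGL 2 E).comap (adelicVal F E c 2 ((StdForm.antidiagonal 2).over E)) : Subgroup (quasiSplit F E c 2).Adelic), φ (y * k) = φ y) (hφT : ∀ y : (quasiSplit F E c 2).Adelic, φ ((quasiSplit F E c 2).toAdelic (weylLongU (c : E →+* E) (rfl : (StdForm.antidiagonal 2).over E = (StdForm.antidiagonal 2).over E)) * (((t₀ : borelAdelic F E c 2) : (quasiSplit F E c 2).Adelic) * y)) = φ ((quasiSplit F E c 2).toAdelic (weylLongU (c : E →+* E) (rfl : (StdForm.antidiagonal 2).over E = (StdForm.antidiagonal 2).over E)) * y)) (z : ℂ)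
    {x : AdeleRing (𝓞 F) F} {k g : (quasiSplit F E c 2).Adelic} (hk : k ∈ ((standardMaximalCompactGL 2 E).comap (adelicVal F E c 2 ((StdForm.antidiagonal 2).over E)) : Subgroup (quasiSplit F E c 2).Adelic)) (hg : g = ((middleRootUnipotent hij hN (Multiplicative.ofAdd (traceZeroLine F E c hcδ hδ (x))) : ↥(adelicUnipotent F E c 2)) : (quasiSplit F E c 2).Adelic) * ((t₀ : borelAdelic F E c 2) : (quasiSplit F E c 2).Adelic) * k) (ξ : F) :
    adeleFourierCoeff μ (fun t : AdeleRing (𝓞 F) F => flatSectionU φ z ((quasiSplit F E c 2).toAdelic (weylLongU (c : E →+* E) (rfl : (StdForm.antidiagonal 2).over E = (StdForm.antidiagonal 2).over E)) * ((middleRootUnipotent hij hN (Multiplicative.ofAdd (traceZeroLine F E c hcδ hδ (t))) : ↥(adelicUnipotent F E c 2)) : (quasiSplit F E c 2).Adelic) * g)) ξ =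
      ((IdeleClassGroup.ideleNorm E (d 0) : ℝ) : ℂ) ^ (1 - z) * (adeleAddChar F (algebraMap F (AdeleRing (𝓞 F) F) ξ * -x) : ℂ) *
        ∫ v, flatSectionU φ z ((quasiSplit F E c 2).toAdelic (weylLongU (c : E →+* E) (rfl : (StdForm.antidiagonal 2).over E = (StdForm.antidiagonal 2).over E)) * ((middleRootUnipotent hij hN (Multiplicative.ofAdd (traceZeroLine F E c hcδ hδ (v))) : ↥(adelicUnipotent F E c 2)) : (quasiSplit F E c 2).Adelic)) * (adeleAddChar F (algebraMap F (AdeleRing (𝓞 F) F) ξ * ((α⁻¹ : (AdeleRing (𝓞 F) F)ˣ) : AdeleRing (𝓞 F) F) * v) : ℂ) ∂μ := by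
  subst hg
  have hpos : (0 : ℝ) < (IdeleClassGroup.ideleNorm E (d 0) : ℝ) := ideleNorm_real_pos _
  have hne : ((IdeleClassGroup.ideleNorm E (d 0) : ℝ) : ℂ) ≠ 0 := Complex.ofReal_ne_zero.2 hpos.ne'
  have hassoc : (fun t : AdeleRing (𝓞 F) F => flatSectionU φ z ((quasiSplit F E c 2).toAdelic (weylLongU (c : E →+* E) (rfl : (StdForm.antidiagonal 2).over E = (StdForm.antidiagonal 2).over E)) * ((middleRootUnipotent hij hN (Multiplicative.ofAdd (traceZeroLine F E c hcδ hδ (t))) : ↥(adelicUnipotent F E c 2)) : (quasiSplit F E c 2).Adelic) * (((middleRootUnipotent hij hN (Multiplicative.ofAdd (traceZeroLine F E c hcδ hδ (x))) : ↥(adelicUnipotent F E c 2)) : (quasiSplit F E c 2).Adelic) * ((t₀ : borelAdelic F E c 2) : (quasiSplit F E c 2).Adelic) * k))) =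
      fun t : AdeleRing (𝓞 F) F => flatSectionU φ z ((quasiSplit F E c 2).toAdelic (weylLongU (c : E →+* E) (rfl : (StdForm.antidiagonal 2).over E = (StdForm.antidiagonal 2).over E)) * (((middleRootUnipotent hij hN (Multiplicative.ofAdd (traceZeroLine F E c hcδ hδ (t))) : ↥(adelicUnipotent F E c 2)) : (quasiSplit F E c 2).Adelic) * (((middleRootUnipotent hij hN (Multiplicative.ofAdd (traceZeroLine F E c hcδ hδ (x))) : ↥(adelicUnipotent F E c 2)) : (quasiSplit F E c 2).Adelic) * (((t₀ : borelAdelic F E c 2) : (quasiSplit F E c 2).Adelic) * k)))) := by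
    funext t
    simp only [mul_assoc]
  rw [hassoc, adeleFourierCoeff_bigCellLine_chart_torus hij hN hcδ hδ μ t₀ hd hα hφK hφT z x hk ξ, hα', NNReal.coe_inv, inv_inv, Complex.real_smul,
    Complex.cpow_sub _ _ hne, Complex.cpow_one, Complex.cpow_neg, div_eq_mul_inv]
  field_simp

end Fourier

end Summit.HodgeConjecture.HodgeConjecture.Cruxes.H413.K2E1WhittakerCoefficientCovarianceU2

end
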